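import Mathlib.AlgebraicGeometry.EllipticCurve.Affine.Point
import Mathlib.GroupTheory.Torsion
import Mathlib.LinearAlgebra.Dimension.Finrank
import HarnessLib

/-!
# Points under an admissible change of variables

For a Weierstrass curve `W` over a commutative ring `R` and an admissible change of variables
`C = (u, r, s, t)` (Mathlib `WeierstrassCurve.VariableChange`, acting by `C • W`), the
substitution `x = u²x' + r`, `y = u³y' + u²sx' + t` (Silverman, *The Arithmetic of Elliptic
Curves*, III.1, p. 42, and Table 3.1) identifies the affine points of `W` with those of
`W' = C • W`: `(x, y) ↦ (x', y') = (u⁻²(x - r), u⁻³(y - s(x - r) - t))`. Mathlib has the action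
on the coefficients (`variableChange_a₁`, …, `variableChange_Δ`, `variableChange_j`) but not the
induced map on points (searched `Mathlib/AlgebraicGeometry/EllipticCurve/`: `VariableChange`
occurs only in `VariableChange`, `Affine/Basic` (`equation_iff_variableChange` for the
translation `(1, x, 0, y)`), `NormalForms`, `IsomOfJ`, `Reduction`). This file supplies it:

* `VariableChange.toX`, `toY`, `ofX`, `ofY`: the new coordinates in terms of the old ones and
  back, mutually inverse (`ofX_toX`, `toX_ofX`, `ofY_toY`, `toY_ofY`);
* the polynomial identities `W'(x', y') = u⁻⁶ W(x, y)`, `W'_{x'} = u⁻⁴ (W_x + s W_y)`,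
  `W'_{y'} = u⁻³ W_y` (`evalEval_polynomial_toXY`, `…polynomialX…`, `…polynomialY…`), whence
  `equation_iff`, `nonsingular_iff` (over any commutative ring) and, over a field, the
  transformation of the addition formulas: `negY`, the slope `λ' = u⁻¹(λ - s)` (`slope_toXY`),
  `addX`, `negAddY`, `addY`;
* `VariableChange.pointEquiv W C : W⟮F⟯ ≃+ (C • W)⟮F⟯`, the induced isomorphism of the groups of
  nonsingular `F`-points (the composition law III.2.1 is defined in terms of lines in `ℙ²`,
  which a linear change of variables preserves — Silverman, *AEC*, proof of III.2.5, p. 56;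
  here verified on the explicit formulas of the Group Law Algorithm III.2.3), with
  `pointEquiv_some`, and its consequences `finrank_point_variableChange`
  (`rank_ℤ (C • W)(F) = rank_ℤ W(F)`) and `natCard_torsion_point_variableChange`
  (`#(C • W)(F)_tors = #W(F)_tors`).

Everything is proved (no named facts). The group-law lemmas take `[DecidableEq F]` exactly as
Mathlib's `WeierstrassCurve.Affine.Point` API does, so they apply verbatim under
`open scoped Classical`.

## References

* J. H. Silverman, *The Arithmetic of Elliptic Curves*, 2nd ed., GTM 106 (2009), III.1,
  p. 42 (the substitution `x = u²x' + r`, `y = u³y' + u²sx' + t`) and Table 3.1 (the `aᵢ'`),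
  Group Law Algorithm III.2.3 (p. 53), proof of Prop. III.2.5 (p. 56), Prop. III.3.1(b) (p. 59).
-/

noncomputable section

namespace WeierstrassCurve.VariableChange

section Ring

variable {R : Type*} [CommRing R] (W : WeierstrassCurve R) (C : VariableChange R)

/-! ### The substitution and its inverse -/

/-- The new `x`-coordinate `x' = u⁻²(x - r)` of the point `(x, y)` of `W` on `C • W`
(Silverman, *AEC*, III.1: `x = u²x' + r`). [cite: SilvermanAEC2009, III.1 Table 3.1] -/
def toX (x : R) : R :=
  C.u⁻¹ ^ 2 * (x - C.r)

/-- The new `y`-coordinate `y' = u⁻³(y - s(x - r) - t)` of the point `(x, y)` of `W` on `C • W`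
(Silverman, *AEC*, III.1: `y = u³y' + u²sx' + t`). [cite: SilvermanAEC2009, III.1 Table 3.1] -/
def toY (x y : R) : R :=
  C.u⁻¹ ^ 3 * (y - C.s * (x - C.r) - C.t)

/-- The old `x`-coordinate `x = u²x' + r` of the point `(x', y')` of `C • W`
(Silverman, *AEC*, III.1). [cite: SilvermanAEC2009, III.1 Table 3.1] -/
def ofX (x' : R) : R :=
  C.u ^ 2 * x' + C.r

/-- The old `y`-coordinate `y = u³y' + u²sx' + t` of the point `(x', y')` of `C • W`
(Silverman, *AEC*, III.1). [cite: SilvermanAEC2009, III.1 Table 3.1] -/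
def ofY (x' y' : R) : R :=
  C.u ^ 3 * y' + C.u ^ 2 * C.s * x' + C.t

/-- Unfolding of `toX` (by definition). [folklore] -/
theorem toX_def (x : R) : C.toX x = C.u⁻¹ ^ 2 * (x - C.r) := rfl

/-- Unfolding of `toY` (by definition). [folklore] -/
theorem toY_def (x y : R) : C.toY x y = C.u⁻¹ ^ 3 * (y - C.s * (x - C.r) - C.t) := rfl

/-- Unfolding of `ofX` (by definition). [folklore] -/
theorem ofX_def (x' : R) : C.ofX x' = C.u ^ 2 * x' + C.r := rfl

/-- Unfolding of `ofY` (by definition). [folklore] -/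
theorem ofY_def (x' y' : R) : C.ofY x' y' = C.u ^ 3 * y' + C.u ^ 2 * C.s * x' + C.t := rfl

/-- `x ↦ x'` then `x' ↦ x` is the identity. [folklore] -/
@[simp]
theorem ofX_toX (x : R) : C.ofX (C.toX x) = x := by
  simp only [ofX, toX]
  linear_combination (x - C.r) * pow_mul_pow_eq_one 2 C.u.mul_inv

/-- `x' ↦ x` then `x ↦ x'` is the identity. [folklore] -/
@[simp]
theorem toX_ofX (x' : R) : C.toX (C.ofX x') = x' := by
  simp only [ofX, toX]
  linear_combination x' * pow_mul_pow_eq_one 2 C.u.inv_mul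

/-- `(x, y) ↦ (x', y')` then back is the identity on the `y`-coordinate. [folklore] -/
@[simp]
theorem ofY_toY (x y : R) : C.ofY (C.toX x) (C.toY x y) = y := by
  simp only [ofY, toX, toY]
  linear_combination (y - C.s * (x - C.r) - C.t) * pow_mul_pow_eq_one 3 C.u.mul_inv
    + C.s * (x - C.r) * pow_mul_pow_eq_one 2 C.u.mul_inv

/-- `(x', y') ↦ (x, y)` then back is the identity on the `y'`-coordinate. [folklore] -/
@[simp]
theorem toY_ofY (x' y' : R) : C.toY (C.ofX x') (C.ofY x' y') = y' := by
  simp only [ofX, ofY, toY]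
  linear_combination y' * pow_mul_pow_eq_one 3 C.u.inv_mul

/-- `x ↦ x'` is injective. [folklore] -/
theorem toX_injective : Function.Injective C.toX := fun x₁ x₂ h => by
  simpa only [ofX_toX] using congrArg C.ofX h

/-! ### The Weierstrass polynomial and its partial derivatives under the substitution -/

/-- `W'(x', y') = u⁻⁶ · W(x, y)` for `W' = C • W`: the defining property of the action of `C` on
the coefficients (Silverman, *AEC*, III.1, Table 3.1). [cite: SilvermanAEC2009, III.1 Table 3.1] -/
theorem evalEval_polynomial_toXY (x y : R) :
    (C • W).toAffine.polynomial.evalEval (C.toX x) (C.toY x y) =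
      C.u⁻¹ ^ 6 * W.toAffine.polynomial.evalEval x y := by
  simp only [Affine.evalEval_polynomial, toX, toY, variableChange_a₁, variableChange_a₂,
    variableChange_a₃, variableChange_a₄, variableChange_a₆]
  ring

/-- `W'_{x'}(x', y') = u⁻⁴ (W_x(x, y) + s · W_y(x, y))` (chain rule for the substitution
`x = u²x' + r`, `y = u³y' + u²sx' + t`). [folklore] -/
theorem evalEval_polynomialX_toXY (x y : R) :
    (C • W).toAffine.polynomialX.evalEval (C.toX x) (C.toY x y) =
      C.u⁻¹ ^ 4 * (W.toAffine.polynomialX.evalEval x y +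
        C.s * W.toAffine.polynomialY.evalEval x y) := by
  simp only [Affine.evalEval_polynomialX, Affine.evalEval_polynomialY, toX, toY,
    variableChange_a₁, variableChange_a₂, variableChange_a₄]
  ring

/-- `W'_{y'}(x', y') = u⁻³ W_y(x, y)` (chain rule). [folklore] -/
theorem evalEval_polynomialY_toXY (x y : R) :
    (C • W).toAffine.polynomialY.evalEval (C.toX x) (C.toY x y) =
      C.u⁻¹ ^ 3 * W.toAffine.polynomialY.evalEval x y := by
  simp only [Affine.evalEval_polynomialY, toX, toY, variableChange_a₁, variableChange_a₃]
  ring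

/-- `(x', y')` lies on `C • W` iff `(x, y)` lies on `W`. Silverman, *AEC*, III.1. [folklore] -/
theorem equation_iff (x y : R) :
    (C • W).toAffine.Equation (C.toX x) (C.toY x y) ↔ W.toAffine.Equation x y := by
  rw [Affine.Equation, Affine.Equation, evalEval_polynomial_toXY]
  exact (C.u⁻¹.isUnit.pow 6).mul_right_eq_zero

/-- `(x', y')` is a nonsingular point of `C • W` iff `(x, y)` is a nonsingular point of `W` (the
gradient transforms by an invertible triangular matrix). Silverman, *AEC*, III.1. [folklore] -/
theorem nonsingular_iff (x y : R) :
    (C • W).toAffine.Nonsingular (C.toX x) (C.toY x y) ↔ W.toAffine.Nonsingular x y := by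
  rw [Affine.Nonsingular, Affine.Nonsingular, equation_iff, evalEval_polynomialX_toXY,
    evalEval_polynomialY_toXY, Ne, Ne, (C.u⁻¹.isUnit.pow 4).mul_right_eq_zero,
    (C.u⁻¹.isUnit.pow 3).mul_right_eq_zero]
  refine and_congr Iff.rfl ⟨?_, ?_⟩
  · rintro (h | h)
    · by_cases hX : W.toAffine.polynomialX.evalEval x y = 0
      · right
        intro hY
        apply h
        rw [hX, hY, mul_zero, add_zero]
      · exact Or.inl hX
    · exact Or.inr h
  · rintro (h | h)
    · by_cases hY : W.toAffine.polynomialY.evalEval x y = 0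
      · left
        rwa [hY, mul_zero, add_zero]
      · exact Or.inr hY
    · exact Or.inr h

/-- Nonsingularity of the inverse image: `(x', y')` is nonsingular on `C • W` iff
`(u²x' + r, u³y' + u²sx' + t)` is nonsingular on `W`. [folklore] -/
theorem nonsingular_ofXY_iff (x' y' : R) :
    W.toAffine.Nonsingular (C.ofX x') (C.ofY x' y') ↔ (C • W).toAffine.Nonsingular x' y' := by
  rw [← nonsingular_iff W C, toX_ofX, toY_ofY]

/-! ### The addition formulas under the substitution -/

/-- Negation commutes with the substitution: `-(x', y') = (x', (negY x y)')`.
Silverman, *AEC*, III.2.3. [folklore] -/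
theorem negY_toXY (x y : R) :
    (C • W).toAffine.negY (C.toX x) (C.toY x y) = C.toY x (W.toAffine.negY x y) := by
  simp only [Affine.negY, toX, toY, variableChange_a₁, variableChange_a₃]
  ring

/-- The `x`-coordinate of a sum transforms like a coordinate when the slope transforms as
`λ' = u⁻¹(λ - s)`. Silverman, *AEC*, III.2.3. [folklore] -/
theorem addX_toXY (x₁ x₂ L : R) :
    (C • W).toAffine.addX (C.toX x₁) (C.toX x₂) (C.u⁻¹ * (L - C.s)) =
      C.toX (W.toAffine.addX x₁ x₂ L) := by
  simp only [Affine.addX, toX, variableChange_a₁, variableChange_a₂]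
  ring

/-- The `y`-coordinate of the third intersection point transforms like a coordinate.
Silverman, *AEC*, III.2.3. [folklore] -/
theorem negAddY_toXY (x₁ x₂ y₁ L : R) :
    (C • W).toAffine.negAddY (C.toX x₁) (C.toX x₂) (C.toY x₁ y₁) (C.u⁻¹ * (L - C.s)) =
      C.toY (W.toAffine.addX x₁ x₂ L) (W.toAffine.negAddY x₁ x₂ y₁ L) := by
  simp only [Affine.negAddY, Affine.addX, toX, toY, variableChange_a₁, variableChange_a₂]
  ring

/-- The `y`-coordinate of a sum transforms like a coordinate. Silverman, *AEC*, III.2.3. [folklore] -/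
theorem addY_toXY (x₁ x₂ y₁ L : R) :
    (C • W).toAffine.addY (C.toX x₁) (C.toX x₂) (C.toY x₁ y₁) (C.u⁻¹ * (L - C.s)) =
      C.toY (W.toAffine.addX x₁ x₂ L) (W.toAffine.addY x₁ x₂ y₁ L) := by
  simp only [Affine.addY, addX_toXY, negAddY_toXY, negY_toXY]

end Ring

section Field

variable {F : Type*} [Field F] (W : WeierstrassCurve F) (C : VariableChange F)

/-- Being opposite points is preserved by the substitution. [folklore] -/
theorem toXY_eq_negY_iff {x₁ x₂ y₁ y₂ : F} :
    (C.toX x₁ = C.toX x₂ ∧ C.toY x₁ y₁ = (C • W).toAffine.negY (C.toX x₂) (C.toY x₂ y₂)) ↔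
      (x₁ = x₂ ∧ y₁ = W.toAffine.negY x₂ y₂) := by
  constructor
  · rintro ⟨hx, hy⟩
    obtain rfl := C.toX_injective hx
    rw [negY_toXY] at hy
    exact ⟨rfl, by simpa only [ofY_toY] using congrArg (C.ofY (C.toX x₁)) hy⟩
  · rintro ⟨rfl, rfl⟩
    exact ⟨rfl, (negY_toXY W C x₁ _).symm⟩

/-! ### The induced maps on points -/

/-- The map on nonsingular points induced by the change of variables `C`:
`𝒪 ↦ 𝒪`, `(x, y) ↦ (u⁻²(x - r), u⁻³(y - s(x - r) - t))`, a point of `C • W`.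
Silverman, *AEC*, III.1 and III.3.1(b). [cite: SilvermanAEC2009, III.3.1(b)] -/
def pointMap : W.toAffine.Point → (C • W).toAffine.Point
  | .zero => .zero
  | .some x y h => .some (C.toX x) (C.toY x y) ((nonsingular_iff W C x y).mpr h)

/-- The inverse map on nonsingular points: `(x', y') ↦ (u²x' + r, u³y' + u²sx' + t)`.
Silverman, *AEC*, III.1. [cite: SilvermanAEC2009, III.3.1(b)] -/
def pointInv : (C • W).toAffine.Point → W.toAffine.Point
  | .zero => .zero
  | .some x' y' h => .some (C.ofX x') (C.ofY x' y') ((nonsingular_ofXY_iff W C x' y').mpr h)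

/-- `pointMap` sends `𝒪` to `𝒪` (by definition). [folklore] -/
@[simp]
theorem pointMap_zero : pointMap W C 0 = 0 := rfl

/-- `pointMap` on an affine point (by definition). [folklore] -/
@[simp]
theorem pointMap_some {x y : F} (h : W.toAffine.Nonsingular x y) :
    pointMap W C (.some x y h) = .some (C.toX x) (C.toY x y) ((nonsingular_iff W C x y).mpr h) :=
  rfl

/-- `pointInv` sends `𝒪` to `𝒪` (by definition). [folklore] -/
@[simp]
theorem pointInv_zero : pointInv W C 0 = 0 := rfl

/-- `pointInv` on an affine point (by definition). [folklore] -/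
@[simp]
theorem pointInv_some {x' y' : F} (h : (C • W).toAffine.Nonsingular x' y') :
    pointInv W C (.some x' y' h) =
      .some (C.ofX x') (C.ofY x' y') ((nonsingular_ofXY_iff W C x' y').mpr h) :=
  rfl

/-- `pointInv` is a left inverse of `pointMap`. [folklore] -/
theorem pointInv_pointMap (P : W.toAffine.Point) : pointInv W C (pointMap W C P) = P := by
  rcases P with _ | ⟨x, y, h⟩
  · rfl
  · simp only [pointMap_some, pointInv_some, ofX_toX, ofY_toY]

/-- `pointInv` is a right inverse of `pointMap`. [folklore] -/
theorem pointMap_pointInv (P : (C • W).toAffine.Point) : pointMap W C (pointInv W C P) = P := by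
  rcases P with _ | ⟨x, y, h⟩
  · rfl
  · simp only [pointMap_some, pointInv_some, toX_ofX, toY_ofY]

variable [DecidableEq F]

/-! ### The group law under the substitution -/

/-- The slope of the line through two points of `W` (tangent if they coincide) transforms as
`λ' = u⁻¹(λ - s)` (from `dy/dx = u λ' + s`); both points must lie on `W` and not be opposite,
otherwise Mathlib's `slope` takes the junk value `0`. Silverman, *AEC*, III.2.3. [folklore] -/
theorem slope_toXY {x₁ x₂ y₁ y₂ : F} (h₁ : W.toAffine.Equation x₁ y₁)
    (h₂ : W.toAffine.Equation x₂ y₂) (hxy : ¬(x₁ = x₂ ∧ y₁ = W.toAffine.negY x₂ y₂)) :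
    (C • W).toAffine.slope (C.toX x₁) (C.toX x₂) (C.toY x₁ y₁) (C.toY x₂ y₂) =
      C.u⁻¹ * (W.toAffine.slope x₁ x₂ y₁ y₂ - C.s) := by
  have hv : ((C.u⁻¹ : Fˣ) : F) ≠ 0 := C.u⁻¹.ne_zero
  by_cases hx : x₁ = x₂
  · subst hx
    have hy : y₁ ≠ W.toAffine.negY x₁ y₂ := fun h => hxy ⟨rfl, h⟩
    obtain rfl : y₁ = y₂ := by
      rcases Affine.Y_eq_of_X_eq h₁ h₂ rfl with h | h
      · exact h
      · exact absurd h hy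
    have hPY : W.toAffine.polynomialY.evalEval x₁ y₁ ≠ 0 := by
      rw [Affine.evalEval_polynomialY]
      intro h
      apply hy
      simp only [Affine.negY]
      linear_combination h
    have hy' : C.toY x₁ y₁ ≠ (C • W).toAffine.negY (C.toX x₁) (C.toY x₁ y₁) := by
      rw [negY_toXY]
      intro h
      exact hy (by simpa only [ofY_toY] using congrArg (C.ofY (C.toX x₁)) h)
    rw [Affine.slope_of_Y_ne_eq_evalEval rfl hy', Affine.slope_of_Y_ne_eq_evalEval rfl hy,
      evalEval_polynomialX_toXY, evalEval_polynomialY_toXY]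
    field_simp
    ring
  · have hx' : C.toX x₁ ≠ C.toX x₂ := fun h => hx (C.toX_injective h)
    have hsub : x₁ - x₂ ≠ 0 := sub_ne_zero.mpr hx
    have hden : C.toX x₁ - C.toX x₂ = C.u⁻¹ ^ 2 * (x₁ - x₂) := by
      simp only [toX]
      ring
    have hnum : C.toY x₁ y₁ - C.toY x₂ y₂ = C.u⁻¹ ^ 3 * ((y₁ - y₂) - C.s * (x₁ - x₂)) := by
      simp only [toY]
      ring
    rw [Affine.slope_of_X_ne hx', Affine.slope_of_X_ne hx, hnum, hden]
    field_simp

/-- The substitution respects the group law (Silverman, *AEC*, proof of III.2.5, p. 56: the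
composition law III.2.1 is defined in terms of lines in `ℙ²`, so it is preserved by a linear
change of variables; here checked on the explicit formulas of the Group Law Algorithm III.2.3:
opposite points go to opposite points, and otherwise slope, `x(P + Q)` and `y(P + Q)` transform
as computed above). [cite: SilvermanAEC2009, III.2.3 and proof of III.2.5] -/
theorem pointMap_add (P Q : W.toAffine.Point) :
    pointMap W C (P + Q) = pointMap W C P + pointMap W C Q := by
  rcases P with _ | ⟨x₁, y₁, h₁⟩ <;> rcases Q with _ | ⟨x₂, y₂, h₂⟩
  · rfl
  · rfl
  · rfl
  · by_cases hxy : x₁ = x₂ ∧ y₁ = W.toAffine.negY x₂ y₂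
    · have hxy' := (toXY_eq_negY_iff W C).mpr hxy
      rw [Affine.Point.add_of_Y_eq hxy.1 hxy.2, pointMap_some, pointMap_some,
        Affine.Point.add_of_Y_eq hxy'.1 hxy'.2, pointMap_zero]
    · have hxy' : ¬(C.toX x₁ = C.toX x₂ ∧
          C.toY x₁ y₁ = (C • W).toAffine.negY (C.toX x₂) (C.toY x₂ y₂)) :=
        fun h => hxy ((toXY_eq_negY_iff W C).mp h)
      rw [Affine.Point.add_some hxy, pointMap_some, pointMap_some, pointMap_some,
        Affine.Point.add_some hxy']
      simp only [slope_toXY W C h₁.1 h₂.1 hxy, addX_toXY, addY_toXY]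

/-- **The isomorphism of point groups induced by an admissible change of variables**
(Silverman, *AEC*, III.1 p. 42 and Prop. III.3.1(b): the substitutions relating two Weierstrass
equations of the same curve; group isomorphism by the proof of III.2.5, p. 56):
`W(F) ≃+ (C • W)(F)`, `(x, y) ↦ (u⁻²(x - r), u⁻³(y - s(x - r) - t))`, with inverse
`(x', y') ↦ (u²x' + r, u³y' + u²sx' + t)`. [cite: SilvermanAEC2009, III.3.1(b) and proof of III.2.5] -/
def pointEquiv : W.toAffine.Point ≃+ (C • W).toAffine.Point where
  toFun := pointMap W C
  invFun := pointInv W C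
  left_inv := pointInv_pointMap W C
  right_inv := pointMap_pointInv W C
  map_add' := pointMap_add W C

/-- `pointEquiv` is `pointMap` as a function (by definition). [folklore] -/
@[simp]
theorem pointEquiv_apply (P : W.toAffine.Point) : pointEquiv W C P = pointMap W C P := rfl

/-- The inverse of `pointEquiv` is `pointInv` (by definition). [folklore] -/
@[simp]
theorem pointEquiv_symm_apply (P : (C • W).toAffine.Point) :
    (pointEquiv W C).symm P = pointInv W C P := rfl

/-- `pointEquiv` sends `𝒪` to `𝒪`. [folklore] -/
theorem pointEquiv_zero : pointEquiv W C 0 = 0 := rfl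

/-- `pointEquiv` on an affine point: `(x, y) ↦ (u⁻²(x - r), u⁻³(y - s(x - r) - t))`
(Silverman, *AEC*, III.1, p. 42). [cite: SilvermanAEC2009, III.1 Table 3.1] -/
theorem pointEquiv_some {x y : F} (h : W.toAffine.Nonsingular x y) :
    pointEquiv W C (.some x y h) =
      .some (C.toX x) (C.toY x y) ((nonsingular_iff W C x y).mpr h) :=
  rfl

/-! ### Consequences: rank and torsion are isomorphism invariants -/

/-- The `ℤ`-rank of the group of `F`-points is invariant under admissible changes of variables:
`rank_ℤ (C • W)(F) = rank_ℤ W(F)` (`Module.finrank` along the `ℤ`-linear equivalence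
`pointEquiv`). Silverman, *AEC*, III.3.1(b) with VIII.6. [folklore] -/
theorem finrank_point_variableChange :
    Module.finrank ℤ (C • W).toAffine.Point = Module.finrank ℤ W.toAffine.Point :=
  ((pointEquiv W C).toIntLinearEquiv.finrank_eq).symm

/-- `pointEquiv` restricts to a bijection of torsion subgroups. Silverman, *AEC*, III.3.1(b). [folklore] -/
def torsionEquiv :
    AddCommGroup.torsion W.toAffine.Point ≃ AddCommGroup.torsion (C • W).toAffine.Point :=
  (pointEquiv W C).toEquiv.subtypeEquiv fun P => by
    change IsOfFinAddOrder P ↔ IsOfFinAddOrder ((pointEquiv W C).toAddMonoidHom P)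
    exact ((pointEquiv W C).injective.isOfFinAddOrder_iff
      (f := (pointEquiv W C).toAddMonoidHom)).symm

/-- The order of the torsion subgroup of the group of `F`-points is invariant under admissible
changes of variables: `#(C • W)(F)_tors = #W(F)_tors` (as `Nat.card`, so also in the infinite,
junk, case). Silverman, *AEC*, III.3.1(b) with VII.3. [folklore] -/
theorem natCard_torsion_point_variableChange :
    Nat.card (AddCommGroup.torsion (C • W).toAffine.Point) =
      Nat.card (AddCommGroup.torsion W.toAffine.Point) :=
  (Nat.card_congr (torsionEquiv W C)).symm

end Field

end WeierstrassCurve.VariableChange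

end
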